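import Literature.Analysis.FluidPDE.TsaiHeadPressure
import Literature.Analysis.FluidPDE.TsaiMaximumPrinciple
import HarnessLib

/-!
# The head pressure of a Leray profile, in coordinates (Tsai 1998, (1.7)) — II: the identity

Analysis/FluidPDE support file for the decomposition of the named fact
`Literature.Analysis.FluidPDE.tsai_selfsimilar` (Tsai, ARMA 143 (1998), Theorem 1), sequel of
`TsaiHeadPressure`. For a Leray profile `(U, P)` (`IsLerayProfile ν a U P` on
`ℝ^ι = EuclideanSpace ℝ ι`) with smooth velocity `U` we prove Tsai's identity (1.7) for the head
pressure `Π = headPressure a U P = ½|U|² + P + a y·U`, written with the drift–Laplace operator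
`driftOp ν a U f y = ν Δf(y) − Df(y)[U(y) + a y]` of `TsaiMaximumPrinciple`:

* `IsLerayProfile.driftOp_headPressure`:
  `ν ΔΠ − DΠ[U + a y] = ν (∑ₗᵢ (∂ₗUᵢ)² − ∑ₗᵢ ∂ₗUᵢ ∂ᵢUₗ) = ν (|∇U|² − tr((∇U)²))`;
* `IsLerayProfile.driftOp_headPressure_eq_half_sum_sq`: `… = (ν/2) ∑ₗᵢ (∂ₗUᵢ − ∂ᵢUₗ)²`, which on
  `ℝ³` is `ν|curl U|²` — Tsai's (1.7) `−νΔΠ + (U + a y)·∇Π = −ν|Ω|²`;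
* `IsLerayProfile.driftOp_headPressure_nonneg`: hence `Π` is a subsolution, `driftOp ≥ 0`
  (`ν ≥ 0`), the hypothesis of Tsai's Liouville-type Lemma 5.1
  (`isConst_of_driftOp_nonneg_of_poly`);
* the end of Tsai's proof of Theorem 1 (p. 48): if `Π` is constant then `∇U` is symmetric
  (`|Ω|² = 0`, `IsLerayProfile.pderiv_comp_symm_of_headPressure_const`) and, comparing `∇Π = 0`
  ((5.2)) with the profile system, `ΔU = 0`
  (`IsLerayProfile.laplacian_eq_zero_of_headPressure_const`).

## Proof of (1.7)

With `w = U + a y`, `TsaiHeadPressure` gives `∂ₗΠ = ∑ᵢ wᵢ ∂ₗUᵢ + ∂ₗP + aUₗ`,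
`∂ₗ∂ₗΠ = ∑ᵢ (∂ₗUᵢ)² + ∑ᵢ wᵢ ∂ₗ∂ₗUᵢ + ∂ₗ∂ₗP + 2a∂ₗUₗ`, `∂ₗP = ν∑ₖ∂ₖ∂ₖUₗ − aUₗ − ∑ⱼ wⱼ∂ⱼUₗ`,
`∑ₗ∂ₗ∂ₗP = −∑ₗⱼ ∂ₗUⱼ∂ⱼUₗ` and `∑ₗ ∂ₗUₗ = 0`. Summing,
`νΔΠ − ∑ₗ wₗ∂ₗΠ = ν|∇U|² + ν∑ wᵢ∂ₗ∂ₗUᵢ − ν tr((∇U)²) − ∑ wₗwᵢ∂ₗUᵢ − ν∑ wₗ∂ₖ∂ₖUₗ + ∑ wₗwⱼ∂ⱼUₗ`,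
and the second/fifth and fourth/sixth terms cancel after exchanging the summation indices
(`driftOp_headPressure_algebra`, pure finite-sum bookkeeping).

## References

* T.-P. Tsai, *On Leray's self-similar solutions of the Navier–Stokes equations satisfying local
  energy estimates*, Arch. Rational Mech. Anal. 143 (1998) 29–51, (1.7), (5.2) and p. 48 (proof
  of Theorems 1 and 2) [Tsai1998].
* J. Nečas, M. Růžička, V. Šverák, *On Leray's self-similar solutions of the Navier–Stokes
  equations*, Acta Math. 176 (1996) 283–294, §2 [NecasRuzickaSverak1996].
-/

noncomputable section

open MeasureTheory Set Function Filter Topology InnerProductSpace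
open scoped ENNReal NNReal ContDiff BigOperators Laplacian RealInnerProductSpace

namespace Literature.Analysis.FluidPDE

section Identity

variable {ι : Type*} [Fintype ι] [DecidableEq ι]

local notation "𝔼" => EuclideanSpace ℝ ι

variable {ν a : ℝ} {U : EuclideanSpace ℝ ι → EuclideanSpace ℝ ι} {P : EuclideanSpace ℝ ι → ℝ}

omit [DecidableEq ι] in
/-- **The finite-sum bookkeeping behind Tsai's identity (1.7).** For a matrix `d = (∂ₗUᵢ)`, a
tensor `dd = (∂ₗ∂ₖUᵢ)`, vectors `w = U + a y`, `u = U`, `p₁ = ∇P`, `p₂ = (∂ₗ∂ₗP)ₗ` tied by the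
pressure Poisson equation `∑ p₂ = −∑ dₗⱼdⱼₗ`, the pressure gradient formula
`p₁ₗ = ν∑ₖ ddₖₖₗ − a uₗ − ∑ⱼ wⱼ dⱼₗ` and `tr d = 0`:
`ν ∑ₗ (∑ᵢ dₗᵢ² + ∑ᵢ wᵢ ddₗₗᵢ + p₂ₗ + 2a dₗₗ) − ∑ₗ wₗ (∑ᵢ wᵢ dₗᵢ + p₁ₗ + a uₗ) = ν (∑ dₗᵢ² − ∑ dₗᵢ dᵢₗ)`
(exchange of summation indices). [folklore] -/
theorem driftOp_headPressure_algebra (d : ι → ι → ℝ) (dd : ι → ι → ι → ℝ) (w u p₁ p₂ : ι → ℝ)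
    (ν a : ℝ) (hPP : ∑ l, p₂ l = -∑ l, ∑ j, d l j * d j l)
    (hdP : ∀ l, p₁ l = ν * ∑ k, dd k k l - a * u l - ∑ j, w j * d j l)
    (hdiv : ∑ l, d l l = 0) :
    ν * ∑ l, (∑ i, d l i ^ 2 + ∑ i, w i * dd l l i + p₂ l + 2 * a * d l l) -
        ∑ l, w l * (∑ i, w i * d l i + p₁ l + a * u l) =
      ν * (∑ l, ∑ i, d l i ^ 2 - ∑ l, ∑ i, d l i * d i l) := by
  have e1 : ∑ l, (∑ i, d l i ^ 2 + ∑ i, w i * dd l l i + p₂ l + 2 * a * d l l) =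
      ∑ l, ∑ i, d l i ^ 2 + ∑ l, ∑ i, w i * dd l l i + ∑ l, p₂ l + 2 * a * ∑ l, d l l := by
    rw [Finset.mul_sum]
    simp only [Finset.sum_add_distrib]
  have e2 : ∑ l, w l * (∑ i, w i * d l i + p₁ l + a * u l) =
      ∑ l, ∑ i, w l * (w i * d l i) + ∑ l, w l * p₁ l + ∑ l, w l * (a * u l) := by
    simp only [mul_add, Finset.sum_add_distrib, Finset.mul_sum]
  have e3 : ∑ l, w l * p₁ l = ∑ l, w l * (ν * ∑ k, dd k k l) - ∑ l, w l * (a * u l) -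
      ∑ l, ∑ j, w l * (w j * d j l) := by
    simp only [hdP, mul_sub, Finset.sum_sub_distrib, Finset.mul_sum]
  have hC : ∑ l, w l * (ν * ∑ k, dd k k l) = ν * ∑ l, ∑ i, w i * dd l l i := by
    simp only [Finset.mul_sum]
    rw [Finset.sum_comm]
    exact Finset.sum_congr rfl fun _ _ => Finset.sum_congr rfl fun _ _ => by ring
  have hD : ∑ l, ∑ j, w l * (w j * d j l) = ∑ l, ∑ i, w l * (w i * d l i) := by
    rw [Finset.sum_comm]
    exact Finset.sum_congr rfl fun _ _ => Finset.sum_congr rfl fun _ _ => by ring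
  rw [e1, e2, e3, hC, hD, hPP, hdiv]
  ring

/-- The head pressure of a smooth-velocity Leray profile is smooth. [folklore] -/
theorem IsLerayProfile.contDiff_headPressure (h : IsLerayProfile ν a U P) (hU : ContDiff ℝ ∞ U) :
    ContDiff ℝ ∞ (headPressure a U P) := by
  have hUc : ∀ i, ContDiff ℝ ∞ (fun z : 𝔼 => U z i) := fun i => contDiff_comp_euclidean hU i
  rw [headPressure_eq_sum]
  exact ((contDiff_const.mul (ContDiff.sum fun i _ => (hUc i).pow 2)).add
    (h.contDiff_pressure_of_smooth hU)).add
    (contDiff_const.mul (ContDiff.sum fun i _ => (contDiff_euclideanCoord i).mul (hUc i)))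

/-- **Tsai 1998, (1.7), gradient form.** For a Leray profile with smooth velocity,
`ν ΔΠ − DΠ[U + a y] = ν (∑ₗᵢ (∂ₗUᵢ)² − ∑ₗᵢ ∂ₗUᵢ ∂ᵢUₗ)` (`= ν(|∇U|² − tr((∇U)²))`), where
`Π = ½|U|² + P + a y·U`. [cite: Tsai1998, (1.7)] -/
theorem IsLerayProfile.driftOp_headPressure (h : IsLerayProfile ν a U P) (hU : ContDiff ℝ ∞ U)
    (y : 𝔼) :
    driftOp ν a U (headPressure a U P) y =
      ν * (∑ l, ∑ i, pderiv l (fun z => U z i) y ^ 2 -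
        ∑ l, ∑ i, pderiv l (fun z => U z i) y * pderiv i (fun z => U z l) y) := by
  have hP : ContDiff ℝ ∞ P := h.contDiff_pressure_of_smooth hU
  have hHead : ContDiff ℝ ∞ (headPressure a U P) := h.contDiff_headPressure hU
  rw [driftOp, laplacian_eq_sum_pderiv_pderiv' (hHead.of_le (WithTop.coe_le_coe.2 le_top)) y,
    fderiv_apply_eq_sum_mul_pderiv]
  simp only [PiLp.add_apply, PiLp.smul_apply, smul_eq_mul]
  rw [Finset.sum_congr rfl fun l _ => congrFun (pderiv_pderiv_headPressure hU hP a l) y,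
    Finset.sum_congr rfl fun l _ =>
      congrArg (fun r => (U y l + a * y l) * r) (congrFun (pderiv_headPressure hU hP a l) y)]
  beta_reduce
  exact driftOp_headPressure_algebra (fun l i => pderiv l (fun z => U z i) y)
    (fun l k i => pderiv l (pderiv k fun z => U z i) y) (fun i => U y i + a * y i) (fun i => U y i)
    (fun l => pderiv l P y) (fun l => pderiv l (pderiv l P) y) ν a
    (h.sum_pderiv_pderiv_pressure hU y) (fun l => congrFun (h.pderiv_pressure_eq l) y)
    (h.sum_pderiv_comp_eq_zero y)

/-- **Tsai 1998, (1.7), vorticity form**: `ν ΔΠ − DΠ[U + a y] = (ν/2) ∑ₗᵢ (∂ₗUᵢ − ∂ᵢUₗ)²`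
(on `ℝ³` the right-hand side is `ν|curl U|²`; in print `−νΔΠ + (U + ay)·∇Π = −ν|Ω|²`). [cite: Tsai1998, (1.7)] -/
theorem IsLerayProfile.driftOp_headPressure_eq_half_sum_sq (h : IsLerayProfile ν a U P)
    (hU : ContDiff ℝ ∞ U) (y : 𝔼) :
    driftOp ν a U (headPressure a U P) y =
      2⁻¹ * ν * ∑ l, ∑ i, (pderiv l (fun z => U z i) y - pderiv i (fun z => U z l) y) ^ 2 := by
  rw [h.driftOp_headPressure hU y,
    sum_sq_eq_half_sum_sq_sub_add (fun l i => pderiv l (fun z => U z i) y)]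
  ring

/-- **The head pressure is a subsolution** (Tsai 1998, (1.7): "Hence `Π` satisfies the maximal
principle"): `−νΔΠ + (U + a y)·∇Π ≤ 0`, i.e. `0 ≤ driftOp ν a U Π`, for `ν ≥ 0` and a Leray
profile with smooth velocity. [cite: Tsai1998, (1.7)] -/
theorem IsLerayProfile.driftOp_headPressure_nonneg (h : IsLerayProfile ν a U P)
    (hU : ContDiff ℝ ∞ U) (hν : 0 ≤ ν) (y : 𝔼) : 0 ≤ driftOp ν a U (headPressure a U P) y := by
  rw [h.driftOp_headPressure_eq_half_sum_sq hU y]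
  exact mul_nonneg (mul_nonneg (by norm_num) hν)
    (Finset.sum_nonneg fun _ _ => Finset.sum_nonneg fun _ _ => sq_nonneg _)


/-- **Constant head pressure forces a symmetric velocity gradient** (Tsai 1998, p. 48: "if we
consider (1.7), we get `|Ω(y)|² = 0`, that is, `∂ᵢUⱼ = ∂ⱼUᵢ` for all `i, j`"), for `ν ≠ 0`. [cite: Tsai1998, p. 48 (proof of Theorems 1 and 2)] -/
theorem IsLerayProfile.pderiv_comp_symm_of_headPressure_const (h : IsLerayProfile ν a U P)
    (hU : ContDiff ℝ ∞ U) (hν : ν ≠ 0)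
    (hc : ∀ x y, headPressure a U P x = headPressure a U P y) (y : 𝔼) (l i : ι) :
    pderiv l (fun z => U z i) y = pderiv i (fun z => U z l) y := by
  have hconst : headPressure a U P = fun _ => headPressure a U P 0 := funext fun x => hc x 0
  have h1 : pderiv l (headPressure a U P) = fun _ => 0 := by rw [hconst, pderiv_const]
  have hdrift : driftOp ν a U (headPressure a U P) y = 0 := by
    rw [driftOp, laplacian_eq_sum_pderiv_pderiv' (by rw [hconst]; exact contDiff_const) y,
      fderiv_apply_eq_sum_mul_pderiv]
    have h2 : ∀ j, pderiv j (pderiv j (headPressure a U P)) y = 0 := fun j => by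
      rw [show pderiv j (headPressure a U P) = fun _ => 0 by rw [hconst, pderiv_const], pderiv_const]
    have h3 : ∀ j, pderiv j (headPressure a U P) y = 0 := fun j => by
      rw [show pderiv j (headPressure a U P) = fun _ => 0 by rw [hconst, pderiv_const]]
    simp [h2, h3]
  rw [h.driftOp_headPressure_eq_half_sum_sq hU y] at hdrift
  have hsum : ∑ l, ∑ i, (pderiv l (fun z => U z i) y - pderiv i (fun z => U z l) y) ^ 2 = 0 := by
    have h2ν : (2⁻¹ * ν) ≠ 0 := mul_ne_zero (by norm_num) hν
    rcases mul_eq_zero.1 hdrift with h' | h'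
    · exact absurd h' h2ν
    · exact h'
  have hl := (Finset.sum_eq_zero_iff_of_nonneg fun l _ =>
    Finset.sum_nonneg fun i _ => sq_nonneg _).1 hsum l (Finset.mem_univ l)
  have hli := (Finset.sum_eq_zero_iff_of_nonneg fun i _ => sq_nonneg _).1 hl i (Finset.mem_univ i)
  exact sub_eq_zero.1 (pow_eq_zero_iff two_ne_zero |>.1 hli)

/-- **Constant head pressure forces a harmonic profile** (Tsai 1998, p. 48: comparing `∇Π = 0`,
(5.2), with the profile system (1.3) using `∂ᵢUⱼ = ∂ⱼUᵢ`, "we get `−νΔUᵢ = 0` for each `i`"),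
for `ν ≠ 0`. [cite: Tsai1998, (5.2) and p. 48] -/
theorem IsLerayProfile.laplacian_eq_zero_of_headPressure_const (h : IsLerayProfile ν a U P)
    (hU : ContDiff ℝ ∞ U) (hν : ν ≠ 0)
    (hc : ∀ x y, headPressure a U P x = headPressure a U P y) (y : 𝔼) : Δ U y = 0 := by
  have hP : ContDiff ℝ ∞ P := h.contDiff_pressure_of_smooth hU
  have hconst : headPressure a U P = fun _ => headPressure a U P 0 := funext fun x => hc x 0
  have hsymm := h.pderiv_comp_symm_of_headPressure_const hU hν hc y
  ext i
  rw [laplacian_apply_comp (hU.of_le (WithTop.coe_le_coe.2 le_top)), PiLp.zero_apply]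
  -- `∂ᵢ Π = 0`
  have hgrad : ∑ j, (U y j + a * y j) * pderiv i (fun z => U z j) y + pderiv i P y + a * U y i = 0 := by
    have := congrFun (pderiv_headPressure hU hP a i) y
    rw [show pderiv i (headPressure a U P) = fun _ => 0 by rw [hconst, pderiv_const]] at this
    exact this.symm
  have hprof := h.profile_comp y i
  have e : ∑ j, (U y j + a * y j) * pderiv i (fun z => U z j) y =
      ∑ j, U y j * pderiv j (fun z => U z i) y + a * ∑ j, y j * pderiv j (fun z => U z i) y := by
    rw [Finset.mul_sum, ← Finset.sum_add_distrib]
    exact Finset.sum_congr rfl fun j _ => by rw [hsymm i j]; ring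
  rw [e] at hgrad
  have : ν * ∑ j, pderiv j (pderiv j fun z => U z i) y = 0 := by linarith
  rcases mul_eq_zero.1 this with h' | h'
  · exact absurd h' hν
  · exact h'

end Identity

end Literature.Analysis.FluidPDE

end
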